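import Summits.KontsevichZagierPeriods.KontsevichZagierPeriods.Theorems.MzvKernelInKZ.Negative.Core
import Literature.NumberTheory.Transcendental.KZProductIdeal
import Literature.NumberTheory.Transcendental.NashCubes

/-!
# `MzvKernelInKZ` (stmt-KontsevichZagierPeriods-3914): negative side — half-angle rational functions and the quarter circle `Q = [(0,1), 2dt/(1+t²)]`

Companion of `Negative/Core.lean` (the Euler chain of `EulerFour.lean`).  To run the
Beukers–Kolk–Calabi proof of `ζ(2) = π²/6`, `ζ(4) = π⁴/90` INSIDE the calculus every trigonometric
substitution is replaced by the rational half-angle parametrisation `t = tan(u/2)`: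
`sin u = 2t/(1+t²)` (`Sn`), `cos u = (1−t²)/(1+t²)` (`Cs`), `du = 2dt/(1+t²)` (`gq`), and the
reflection `u ↦ π/2 − u` becomes the Möbius involution `ρ(t) = (1−t)/(1+t)` (`rho`), under which
`2dt/(1+t²)` is invariant (`gq_rho_mul`).  The quarter circle is the one-dimensional representation
`Q = [(0,1), 2dt/(1+t²)]` (`Qrep`, value `π/2`, never used as a number) and `Q² = [(0,1)², g⊗g]`
(`G2`, the Fubini product).  Continued in `SquareDissection.lean`.

Sources: F. Beukers, J. A. C. Kolk, E. Calabi, *Sums of generalized harmonic series and volumes*, Nieuw Arch. Wisk. (4) 11 (1993), 217–224; M. Kontsevich, D. Zagier, *Periods* (2001), §1.2.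
-/

noncomputable section

namespace Summit.KontsevichZagierPeriods.MzvKernelInKZ.Negative

open Set MeasureTheory MvPolynomial
open Literature.NumberTheory.Transcendental
open Literature.ModelTheory.ExponentialFields (IsSemialgebraic)

/-- `sin u` in the half-angle parameter: `2t/(1+t²)`. [folklore] -/
def Sn (t : ℝ) : ℝ := 2 * t / (1 + t ^ 2)
/-- `cos u` in the half-angle parameter: `(1−t²)/(1+t²)`. [folklore] -/
def Cs (t : ℝ) : ℝ := (1 - t ^ 2) / (1 + t ^ 2)
/-- `du/dt` in the half-angle parameter: `2/(1+t²)`. [folklore] -/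
def gq (t : ℝ) : ℝ := 2 / (1 + t ^ 2)
/-- The reflection `u ↦ π/2 − u` in the half-angle parameter: `t ↦ (1−t)/(1+t)`. [folklore] -/
def rho (t : ℝ) : ℝ := (1 - t) / (1 + t)

/-- Positivity: `one_add_sq_pos`. [folklore] -/
theorem one_add_sq_pos (t : ℝ) : 0 < 1 + t ^ 2 := by positivity
/-- Auxiliary lemma `one_add_sq_ne` (see the module docstring). [folklore] -/
theorem one_add_sq_ne (t : ℝ) : 1 + t ^ 2 ≠ 0 := (one_add_sq_pos t).ne'

/-- `sin² + cos² = 1` in the half-angle parameter. [folklore] -/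
theorem Sn_sq_add_Cs_sq (t : ℝ) : Sn t ^ 2 + Cs t ^ 2 = 1 := by
  have := one_add_sq_ne t
  simp only [Sn, Cs]
  field_simp
  ring

/-- The reflection preserves `(0,1)`. [folklore] -/
theorem rho_mem_Ioo {t : ℝ} (ht : t ∈ Ioo (0 : ℝ) 1) : rho t ∈ Ioo (0 : ℝ) 1 := by
  obtain ⟨h0, h1⟩ := ht
  refine ⟨div_pos (by linarith) (by linarith), (div_lt_one (by linarith)).mpr (by linarith)⟩

/-- The reflection is an involution. [folklore] -/
theorem rho_rho {t : ℝ} (ht : t ≠ -1) : rho (rho t) = t := by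
  have : 1 + t ≠ 0 := fun h => ht (by linarith)
  simp only [rho]
  field_simp
  ring

/-- `sin(π/2 − u) = cos u` in the half-angle parameter. [folklore] -/
theorem Sn_rho {t : ℝ} (ht : t ≠ -1) : Sn (rho t) = Cs t := by
  have : 1 + t ≠ 0 := fun h => ht (by linarith)
  have := one_add_sq_ne t
  simp only [Sn, Cs, rho]
  field_simp
  ring

/-- `cos(π/2 − u) = sin u` in the half-angle parameter. [folklore] -/
theorem Cs_rho {t : ℝ} (ht : t ≠ -1) : Cs (rho t) = Sn t := by
  have : 1 + t ≠ 0 := fun h => ht (by linarith)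
  have := one_add_sq_ne t
  simp only [Sn, Cs, rho]
  field_simp
  ring

/-- Invariance of the form `2dt/(1+t²)` under the reflection: `g(ρ t) · |ρ'(t)| = g(t)`. [folklore] -/
theorem gq_rho_mul {t : ℝ} (ht : t ≠ -1) : gq (rho t) * (2 / (1 + t) ^ 2) = gq t := by
  have : 1 + t ≠ 0 := fun h => ht (by linarith)
  have := one_add_sq_ne t
  simp only [gq, rho]
  field_simp
  ring

/-- The derivative of the reflection is `−2/(1+t)²`. [folklore] -/
theorem hasDerivAt_rho {t : ℝ} (ht : t ≠ -1) : HasDerivAt rho (-2 / (1 + t) ^ 2) t := by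
  have h1 : 1 + t ≠ 0 := fun h => ht (by linarith)
  have hn : HasDerivAt (fun s : ℝ => 1 - s) (-1) t := by
    simpa using (hasDerivAt_id t).const_sub 1
  have hd : HasDerivAt (fun s : ℝ => 1 + s) 1 t := by
    simpa using (hasDerivAt_id t).const_add 1
  have h := hn.div hd h1
  have e : (-1 * (1 + t) - (1 - t) * 1) / (1 + t) ^ 2 = -2 / (1 + t) ^ 2 := by ring
  rw [e] at h
  exact h

/-- Positivity: `Sn_pos`. [folklore] -/
theorem Sn_pos {t : ℝ} (ht : t ∈ Ioo (0 : ℝ) 1) : 0 < Sn t := by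
  unfold Sn; exact div_pos (by linarith [ht.1]) (one_add_sq_pos t)

/-- Positivity: `Cs_pos`. [folklore] -/
theorem Cs_pos {t : ℝ} (ht : t ∈ Ioo (0 : ℝ) 1) : 0 < Cs t := by
  unfold Cs; exact div_pos (by nlinarith [ht.1, ht.2]) (one_add_sq_pos t)

/-- Auxiliary lemma `Sn_lt_one` (see the module docstring). [folklore] -/
theorem Sn_lt_one {t : ℝ} (ht : t ∈ Ioo (0 : ℝ) 1) : Sn t < 1 := by
  have h := Sn_sq_add_Cs_sq t
  have hc := Cs_pos ht
  have hs := Sn_pos ht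
  nlinarith

/-- Positivity: `gq_pos`. [folklore] -/
theorem gq_pos (t : ℝ) : 0 < gq t := div_pos two_pos (one_add_sq_pos t)

/-- `Sn b − Sn a` has the sign of `b − a` on `(0,1)`. [folklore] -/
theorem Sn_sub_Sn (a b : ℝ) : Sn b - Sn a = 2 * (b - a) * (1 - a * b) / ((1 + a ^ 2) * (1 + b ^ 2)) := by
  have := one_add_sq_ne a; have := one_add_sq_ne b
  simp only [Sn]; field_simp; ring

/-- `sin` is increasing on `(0, π/2)`, in the half-angle parameter. [folklore] -/
theorem Sn_lt_Sn_iff {a b : ℝ} (ha : a ∈ Ioo (0 : ℝ) 1) (hb : b ∈ Ioo (0 : ℝ) 1) : Sn a < Sn b ↔ a < b := by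
  have hab : 0 < 1 - a * b := by nlinarith [ha.1, ha.2, hb.1, hb.2]
  have hden : 0 < (1 + a ^ 2) * (1 + b ^ 2) := by positivity
  rw [← sub_pos, Sn_sub_Sn, div_pos_iff_of_pos_right hden]
  constructor
  · intro h; nlinarith
  · intro h; nlinarith

/-- `sin` is injective on `(0, π/2)`, in the half-angle parameter. [folklore] -/
theorem Sn_inj {a b : ℝ} (ha : a ∈ Ioo (0 : ℝ) 1) (hb : b ∈ Ioo (0 : ℝ) 1) (h : Sn a = Sn b) : a = b := by
  rcases lt_trichotomy a b with hab | hab | hab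
  · exact absurd h ((Sn_lt_Sn_iff ha hb).mpr hab).ne
  · exact hab
  · exact absurd h.symm ((Sn_lt_Sn_iff hb ha).mpr hab).ne

/-! ### The quarter circle `Q` and its square -/

/-- The open interval `(0,1)` as a subset of `ℝ¹`. [folklore] -/
abbrev cube1 : Set (Fin 1 → ℝ) := openUnitCube 1
/-- The open square `(0,1)²`. [folklore] -/
abbrev cube2 : Set (Fin 2 → ℝ) := openUnitCube 2

/-- Membership in `cube1`, unfolded. [folklore] -/
theorem mem_cube1 {x : Fin 1 → ℝ} : x ∈ cube1 ↔ 0 < x 0 ∧ x 0 < 1 := by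
  simp [mem_openUnitCube_iff, Fin.forall_fin_one]

/-- Membership in `cube2`, unfolded. [folklore] -/
theorem mem_cube2 {x : Fin 2 → ℝ} : x ∈ cube2 ↔ (0 < x 0 ∧ x 0 < 1) ∧ (0 < x 1 ∧ x 1 < 1) := by
  simp [mem_openUnitCube_iff, Fin.forall_fin_two]

/-- **The quarter circle** `Q = [(0,1), 2dt/(1+t²)]` (value `∫₀^{π/2} du = π/2`; only its square and
fourth power are used). [folklore] -/
def Qrep : KZ.IntegralRep 1 where
  domain := cube1
  integrand x := gq (x 0)
  isSemialgebraic_domain := isSemialgebraic_openUnitCube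
  isSemialgebraicFunOn_integrand := by
    refine (isSemialgebraicFunOn_aeval_div_aeval (isSemialgebraic_openUnitCube (d := 1))
      (C 2 : MvPolynomial (Fin 1) ℚ) (1 + X 0 ^ 2) fun x _ => ?_).congr fun x _ => ?_
    · simp only [map_add, map_one, map_pow, aeval_X]; exact one_add_sq_ne _
    · simp [gq]
  integrableOn := by
    have hc : Continuous fun x : Fin 1 → ℝ => gq (x 0) := by
      unfold gq
      exact continuous_const.div (continuous_const.add ((continuous_apply 0).pow 2))
        fun x => one_add_sq_ne _
    have hK : IsCompact (Set.Icc (0 : Fin 1 → ℝ) 1) := isCompact_Icc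
    refine (hc.continuousOn.integrableOn_compact hK).mono_set fun x hx => ?_
    rw [mem_cube1] at hx
    exact ⟨fun i => by fin_cases i; simpa using hx.1.le, fun i => by fin_cases i; simpa using hx.2.le⟩

/-- The domain of `Q` is `(0,1)`. [folklore] -/
@[simp] theorem Qrep_domain : Qrep.domain = cube1 := rfl
/-- The integrand of `Q` is `2/(1+t²)`. [folklore] -/
@[simp] theorem Qrep_integrand : Qrep.integrand = fun x => gq (x 0) := rfl

/-- `Q² = [(0,1)², g ⊗ g]`. [folklore] -/
def G2 : KZ.IntegralRep 2 := Qrep.prod Qrep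

/-- The domain of `Q²` is the open square. [folklore] -/
theorem G2_domain : G2.domain = cube2 := by
  ext z
  rw [G2, KZ.IntegralRep.prod_domain, KZ.IntegralRep.mem_prodDomain, Qrep_domain, mem_cube1, mem_cube1,
    mem_cube2]
  simp [Fin.natAdd, Fin.castAdd]

/-- The integrand of `Q²` is `g ⊗ g`. [folklore] -/
theorem G2_integrand_apply (z : Fin 2 → ℝ) : G2.integrand z = gq (z 0) * gq (z 1) := by
  rw [G2, KZ.IntegralRep.prod_integrand_eq, KZ.IntegralRep.prodFun_apply, Qrep_integrand]
  simp [Fin.natAdd, Fin.castAdd]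

/-- `[Q]·[Q] = [Q²]` in the formal ring (Fubini product). [folklore] -/
theorem of_Qrep_mul_of_Qrep : KZ.of Qrep * KZ.of Qrep = KZ.of G2 := KZ.of_mul_of _ _

end Summit.KontsevichZagierPeriods.MzvKernelInKZ.Negative
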